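import Summits.QuantumAdvantage.QuantumAdvantage.Theorems.WhiteBoxWalkWbwVerifiableLineNoSpeedupCycleSurgeryDefs

/-!
# Crux `WhiteBoxWalk.WbwVerifiableLineNoSpeedup` (stmt-QuantumAdvantage-2239), line
`cycle-surgery-adversary` — ANATOMY and SYMMETRY of the cycle surgery (lead prover)

For a surgery pair `IsSurgery m T S S'` (`S' = S * swap(x_k, v)`, `pre ≤ k < T`, `v` off the line of
`S`, both in the family): the lines agree up to the cut `k`, and beyond it the line of `S'` is
`x'_{k+j} = S^j v` (`1 ≤ j ≤ T - k`), a point off the line of `S` and different from `v` — uniformly in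
the merge case (`v` on another cycle) and the far-split case (`v` further along the source cycle).
Consequences: the relation is SYMMETRIC with the same cut and the same vertex (the planner's former
`stub_surgerySymm`), and the two lines differ exactly at the positions beyond the cut. These are the
facts the counting stubs (`stub_pairProducts`, `stub_degrees`) consume. Sorry-free; no statement of the
route is asserted. -/

noncomputable section

set_option linter.dupNamespace false

namespace Summit.QuantumAdvantage.QuantumAdvantage.Theorems.WbwVerifiableLineNoSpeedup.CycleSurgery

open Literature.Computability.Cryptography Literature.Computability.QuantumComplexity

/-! ## §4 Anatomy and symmetry of the surgery (lead prover) -/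

section Anatomy

variable {m T : ℕ}

/-- **Tail of a surgery.** Let `S' = S * swap(x_k, v)` with `k ≤ T`, `v` off the line of `S`,
`v` of `S`-period `> T - k`, and suppose the lines of `S` and `S'` are both simple. Then for
`k + 1 + j ≤ T` the `(k+1+j)`-th point of the line of `S'` is `S^(j+1) v`, and this point is off
the line of `S` (uniformly in the merge case — `v` on another cycle — and the far-split case). -/
theorem surgery_tail {S : Equiv.Perm (Fin (2 ^ m))} (hinj : Function.Injective (lineOf m T S))
    {k : ℕ} (hk : k ≤ T) {v : Fin (2 ^ m)} (hv : ∀ i : ℕ, i ≤ T → v ≠ pt S i)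
    (hcyc : ∀ j : ℕ, 0 < j → j ≤ T - k → (S ^ j) v ≠ v)
    (hinj' : Function.Injective (lineOf m T (S * Equiv.swap (pt S k) v))) :
    ∀ j : ℕ, k + 1 + j ≤ T →
      pt (S * Equiv.swap (pt S k) v) (k + 1 + j) = (S ^ (j + 1)) v ∧
        ∀ i : ℕ, i ≤ T → (S ^ (j + 1)) v ≠ pt S i := by
  set S' := S * Equiv.swap (pt S k) v with hS'
  -- an orbit point of `v` under `S` that lands on the line of `S` lands on the source,
  -- and then the line of `S'` is not simple
  have offline : ∀ j : ℕ, k + 1 + j ≤ T → pt S' (k + 1 + j) = (S ^ (j + 1)) v →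
      (∀ i : ℕ, i ≤ T → (S ^ j) v ≠ pt S i) → ∀ i : ℕ, i ≤ T → (S ^ (j + 1)) v ≠ pt S i := by
    intro j hj hpt hprev i hi h
    rcases Nat.eq_zero_or_pos i with rfl | hipos
    · -- lands on the source: contradicts simplicity of the line of `S'`
      rw [pt_zero] at h
      have h0 : pt S' (k + 1 + j) = pt S' 0 := by rw [hpt, h, pt_zero]
      have := pt_injOn_of_injective hinj' hj (Nat.zero_le _) h0
      omega
    · -- lands on `x_i`, `i ≥ 1`: then `S^j v = x_{i-1}`
      obtain ⟨i', rfl⟩ : ∃ i', i = i' + 1 := ⟨i - 1, by omega⟩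
      rw [pt_succ, pow_succ', Equiv.Perm.mul_apply] at h
      exact hprev i' (by omega) (S.injective h)
  intro j
  induction j with
  | zero =>
    intro hj
    have hpt : pt S' (k + 1 + 0) = (S ^ (0 + 1)) v := by
      rw [add_zero, zero_add, pow_one, pt_succ, pt_surgery_of_le hinj hk hv k le_rfl, hS',
        surgery_apply_cut]
    refine ⟨hpt, offline 0 hj hpt ?_⟩
    intro i hi
    rw [pow_zero, Equiv.Perm.one_apply]
    exact hv i hi
  | succ j ih =>
    intro hj
    obtain ⟨hpt, hoff⟩ := ih (by omega)
    have hne_cut : (S ^ (j + 1)) v ≠ pt S k := hoff k hk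
    have hne_v : (S ^ (j + 1)) v ≠ v := hcyc (j + 1) (Nat.succ_pos j) (by omega)
    have hpt' : pt S' (k + 1 + (j + 1)) = (S ^ (j + 1 + 1)) v := by
      rw [show k + 1 + (j + 1) = (k + 1 + j) + 1 by omega, pt_succ, hpt, hS',
        surgery_apply_of_ne S hne_cut hne_v, pow_succ' S (j + 1), Equiv.Perm.mul_apply]
    exact ⟨hpt', offline (j + 1) hj hpt' hoff⟩

/-- **Anatomy of a surgery pair.** If `IsSurgery m T S S'` then, for the cut `k` and the vertex
`v` of the definition: the lines agree up to position `k`, and for `k < i ≤ T` the `i`-th point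
of the line of `S'` is `S^(i-k) v`, which is off the line of `S` (in particular differs from
`x_i`) and differs from `v`. -/
theorem IsSurgery.anatomy {S S' : Equiv.Perm (Fin (2 ^ m))} (h : IsSurgery m T S S') :
    ∃ k : ℕ, pre m T ≤ k ∧ k < T ∧ ∃ v : Fin (2 ^ m),
      (∀ i : ℕ, i ≤ T → v ≠ pt S i) ∧ S' = S * Equiv.swap (pt S k) v ∧
      (∀ i : ℕ, i ≤ k → pt S' i = pt S i) ∧
      ∀ i : ℕ, k < i → i ≤ T →
        pt S' i = (S ^ (i - k)) v ∧ (∀ i' : ℕ, i' ≤ T → pt S' i ≠ pt S i') ∧ pt S' i ≠ v := by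
  obtain ⟨hS, hS', k, hk, hkT, v, hv, rfl⟩ := h
  refine ⟨k, hk, hkT, v, hv, rfl, pt_surgery_of_le hS.2.1 hkT.le hv, ?_⟩
  have hcyc : ∀ j : ℕ, 0 < j → j ≤ T - k → (S ^ j) v ≠ v :=
    fun j hj hjk => hS.2.2 v j hj (hjk.trans (sub_le_hid_of_pre_le hk))
  intro i hki hiT
  obtain ⟨j, rfl⟩ : ∃ j, i = k + 1 + j := ⟨i - (k + 1), by omega⟩
  obtain ⟨hpt, hoff⟩ := surgery_tail hS.2.1 hkT.le hv hcyc hS'.2.1 j hiT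
  have hsub : k + 1 + j - k = j + 1 := by omega
  refine ⟨by rw [hpt, hsub], fun i' hi' => by rw [hpt]; exact hoff i' hi', ?_⟩
  rw [hpt]
  exact hcyc (j + 1) (Nat.succ_pos j) (by omega)

/-- **Symmetry of the surgery relation** (the former `stub_surgerySymm`): if `S' = S * swap(x_k, v)`
is a surgery of `S` then `S = S' * swap(x'_k, v)` is a surgery of `S'` with the same cut (the
lines agree up to `k`, so `x'_k = x_k`) and the same vertex `v`, which is off the line of `S'`
(its points beyond the cut are `S^j v ≠ v`, `1 ≤ j ≤ T - k ≤ hid <` period of `v`). -/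
theorem IsSurgery.symm {S S' : Equiv.Perm (Fin (2 ^ m))} (h : IsSurgery m T S S') :
    IsSurgery m T S' S := by
  have hS : InFamily m T S := h.1
  have hS' : InFamily m T S' := h.2.1
  obtain ⟨k, hk, hkT, v, hv, hSS', hagree, htail⟩ := h.anatomy
  refine ⟨hS', hS, k, hk, hkT, v, fun i hi => ?_, ?_⟩
  · rcases Nat.lt_or_ge k i with hki | hik
    · exact fun h => (htail i hki hi).2.2 h.symm
    · rw [hagree i hik]
      exact hv i hi
  · rw [hagree k le_rfl, hSS', mul_assoc, Equiv.swap_mul_self, mul_one]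

/-- Beyond the cut the two lines of a surgery pair are disjoint from each other pointwise:
`x'_i ≠ x_i` for `k < i ≤ T`; below it they agree. Packaged for the counting stubs. -/
theorem IsSurgery.pt_ne_iff {S S' : Equiv.Perm (Fin (2 ^ m))} (h : IsSurgery m T S S') :
    ∃ k : ℕ, pre m T ≤ k ∧ k < T ∧ ∀ i : ℕ, i ≤ T → (pt S' i ≠ pt S i ↔ k < i) := by
  obtain ⟨k, hk, hkT, v, -, -, hagree, htail⟩ := h.anatomy
  refine ⟨k, hk, hkT, fun i hi => ⟨fun hne => ?_, fun hki => (htail i hki hi).2.1 i hi⟩⟩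
  by_contra hki
  exact hne (hagree i (Nat.le_of_not_lt hki))

/-- `∀`-form of `IsSurgery.symm` (the registered sub-goal this file discharges; the planner's
former `stub_surgerySymm`). -/
theorem isSurgery_symm : ∀ (m T : ℕ) (S S' : Equiv.Perm (Fin (2 ^ m))),
    IsSurgery m T S S' → IsSurgery m T S' S := fun _ _ _ _ h => h.symm

end Anatomy

end Summit.QuantumAdvantage.QuantumAdvantage.Theorems.WbwVerifiableLineNoSpeedup.CycleSurgery

end
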